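import Summits.Ventures.HodgeRepro0.P5DegreeIndexCertDefs

/-!
# p5 — the certificate predicate for «[H_M : L_M] = 1», part B: the faster link check

The same certificate as P5DegreeIndexCertDefs (`index_one_of_cert`), with the link μ·W′ = G·(augRows M) checked through
`prodRowZ` — row i of G·B computed as Σ_j G[i][j] • B[j] by `zipWith` / `foldr` (no list indexing inside the sum) instead
of the index sums of `prodRow`; at the large degrees (121 ≤ M ≤ 180, the primes in particular: W′ = 1, G = μ·Wt⁻¹) this is
the dominant cost of the kernel check. `prodRowZ_getD` is the bridge, `index_one_of_cert'` the master lemma for modules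
written in this form. Nothing else changes; the statement `∀ v, Wt M *ᵥ v = 0 → proj v ∈ L M` is the same.
R-5 supporting artefact, never a declaration.
-/

namespace HodgeRepro0.P5.DegreeIndexCert

open HodgeRepro0.P5.LatticeClosureCert
open scoped Matrix

/-- row i of G·B as the vector sum Σ_j G[i][j] • B[j] (c = the number of columns) -/
def prodRowZ (G B : List (List ℤ)) (c i : ℕ) : List ℤ :=
  (List.zipWith (fun g row => smulL g row) (G.getD i []) B).foldr addL (List.replicate c 0)

/-- rows lo ≤ i < hi: μ • (row i of W) = row i of G·B, through `prodRowZ` -/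
def gOKZ (W G B : List (List ℤ)) (c : ℕ) (μ : ℤ) (lo hi : ℕ) : Bool :=
  (List.range' lo (hi - lo)).all fun i => decide (smulL μ (W.getD i []) = prodRowZ G B c i)

/-- what `gOKZ` decides -/
theorem gOKZ_spec {W G B : List (List ℤ)} {c : ℕ} {μ : ℤ} {lo hi : ℕ} (h : gOKZ W G B c μ lo hi = true) :
    ∀ i, lo ≤ i → i < hi → smulL μ (W.getD i []) = prodRowZ G B c i := by
  intro i h1 h2
  simp only [gOKZ, List.all_eq_true, List.mem_range'_1, decide_eq_true_eq] at h
  exact h i ⟨h1, by omega⟩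

/-- the vector sum of scaled rows of length c has length c -/
theorem length_foldr_addL (c : ℕ) : ∀ (gs : List ℤ) (Bs : List (List ℤ)), (∀ row ∈ Bs, row.length = c) →
    ((List.zipWith (fun g row => smulL g row) gs Bs).foldr addL (List.replicate c 0)).length = c := by
  intro gs
  induction gs with
  | nil => intro Bs _; simp
  | cons g gs ih =>
    intro Bs hB
    match Bs with
    | [] => simp
    | row :: Bs' =>
      simp only [List.zipWith_cons_cons, List.foldr_cons]
      rw [length_addL, length_smulL, hB row (by simp), ih Bs' (fun r hr => hB r (by simp [hr])), min_self]

/-- `getD` of the zero list -/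
theorem getD_replicate_zero (c a : ℕ) : (List.replicate c (0 : ℤ)).getD a 0 = 0 := by
  rw [List.getD_eq_getElem?_getD, List.getElem?_replicate]
  split <;> rfl

/-- the entry a of `prodRowZ` is the index sum Σ_j G[i][j] * B[j][a] -/
theorem foldr_addL_getD (c : ℕ) : ∀ (m : ℕ) (gs : List ℤ) (Bs : List (List ℤ)), gs.length = m → Bs.length = m →
    (∀ row ∈ Bs, row.length = c) → ∀ a, a < c →
    ((List.zipWith (fun g row => smulL g row) gs Bs).foldr addL (List.replicate c 0)).getD a 0 =
      ∑ j : Fin m, gs.getD j 0 * (Bs.getD j []).getD a 0 := by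
  intro m
  induction m with
  | zero =>
    intro gs Bs hg hB _ a _
    rw [List.length_eq_zero_iff] at hg hB
    subst hg; subst hB
    simp
  | succ m ih =>
    intro gs Bs hg hB hrows a ha
    match gs, Bs with
    | [], _ => simp at hg
    | _, [] => simp at hB
    | g :: gs', row :: Bs' =>
      simp only [List.length_cons, Nat.add_right_cancel_iff] at hg hB
      have hrows' : ∀ r ∈ Bs', r.length = c := fun r hr => hrows r (by simp [hr])
      simp only [List.zipWith_cons_cons, List.foldr_cons]
      rw [getD_addL _ _ a (by rw [length_smulL, hrows row (by simp)]; exact ha)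
        (by rw [length_foldr_addL c gs' Bs' hrows']; exact ha)]
      rw [ih gs' Bs' hg hB hrows' a ha, Fin.sum_univ_succ]
      simp only [smulL, Fin.val_zero, List.getD_cons_zero, Fin.val_succ, List.getD_cons_succ]
      rw [getD_map_zero _ (mul_zero g)]

/-- row facts `smulL μ (row i of W) = prodRowZ G B i` give μ • W = G·B -/
theorem smul_eq_mul_of_rowsZ (W G B : List (List ℤ)) (k' m c : ℕ) (μ : ℤ) (hG : Lens G k' m) (hB : Lens B m c)
    (h : ∀ i < k', smulL μ (W.getD i []) = prodRowZ G B c i) :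
    μ • matOf k' c W = matOf k' m G * matOf m c B := by
  ext i a
  have hi := congrArg (fun l => l.getD a 0) (h i i.2)
  simp only [prodRowZ] at hi
  rw [foldr_addL_getD c m _ _ (getD_of_mem_length hG i i.2) hB.1 hB.2 a a.2] at hi
  rw [Matrix.smul_apply, Matrix.mul_apply]
  simp only [matOf, Matrix.of_apply, smul_eq_mul]
  rw [← hi, smulL, getD_map_zero _ (mul_zero μ)]

/-- the augmented constraint rows have `kk M` rows of length ⌊M/2⌋ + 1 -/
theorem lens_augRows (M : ℕ) : Lens (augRows M) (kk M) (M / 2 + 1) := by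
  refine ⟨by simp [augRows, kk], ?_⟩
  intro x hx
  simp only [augRows, List.mem_append, List.mem_map, List.mem_singleton] at hx
  rcases hx with ⟨t, _, rfl⟩ | rfl
  · simp [wRow]
  · simp

/-- the master lemma in the `prodRowZ` form -/
theorem index_one_of_cert' (M r k' : ℕ) (Hg HT DT C Wp WT G : List (List ℤ)) (μ : ℤ) (hμ : μ ≠ 0)
    (blocks : List (List (ℤ × Block)))
    (hHT : HT = transposeL Hg (M / 2 + 1) r) (hWT : WT = transposeL Wp (M / 2 + 1) k')
    (hDT : Lens DT (M / 2 + 1) r) (hC : Lens C (M / 2 + 1) k') (hGl : Lens G k' (kk M))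
    (hrows : ∀ i < M / 2 + 1, sumRow HT DT C WT (M / 2 + 1) i = idRow (M / 2 + 1) i)
    (hG : ∀ i < k', smulL μ (Wp.getD i []) = prodRowZ G (augRows M) (M / 2 + 1) i)
    (hB : ∀ j < r, (Hg.getD j []).take (M / 2) = comboVecL M (blocks.getD j []) ∧
      ∀ p ∈ blocks.getD j [], Block.Legit M p.2) :
    ∀ v : Fin (M / 2 + 1) → ℤ, Wt M *ᵥ v = 0 → proj v ∈ L M := by
  intro v hv
  have hHTl : Lens HT (M / 2 + 1) r := by
    rw [hHT]; exact ⟨length_transposeL _ _ _, mem_transposeL_length _ _ _⟩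
  have hWTl : Lens WT (M / 2 + 1) k' := by
    rw [hWT]; exact ⟨length_transposeL _ _ _, mem_transposeL_length _ _ _⟩
  have hI := identity_of_rows HT DT C WT (M / 2 + 1) r k' hHTl hDT hC hWTl hrows
  have hlink := smul_eq_mul_of_rowsZ Wp G (augRows M) k' (kk M) (M / 2 + 1) μ hGl (lens_augRows M) hG
  have hv' : matOf k' (M / 2 + 1) Wp *ᵥ v = 0 := kernel_of_link _ _ _ μ hμ hlink v hv
  have hv'' : (matOf (M / 2 + 1) k' WT)ᵀ *ᵥ v = 0 := by
    rw [hWT, matOf_transposeL, Matrix.transpose_transpose]; exact hv'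
  have hvv := kernel_gen (matOf (M / 2 + 1) r HT) (matOf (M / 2 + 1) r DT)ᵀ (matOf (M / 2 + 1) k' C)
    (matOf (M / 2 + 1) k' WT)ᵀ hI v hv''
  set w := (matOf (M / 2 + 1) r DT)ᵀ *ᵥ v with hw
  have hproj : proj v = ∑ j : Fin r, w j • toFun (M / 2) ((Hg.getD j []).take (M / 2)) := by
    funext a
    rw [proj, hvv, Finset.sum_apply]
    simp only [Matrix.mulVec, dotProduct, Pi.smul_apply, smul_eq_mul, matOf, Matrix.of_apply, hHT, transposeL,
      toFun]
    refine Finset.sum_congr rfl fun j _ => ?_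
    rw [getD_map_range _ (M / 2 + 1) _ a.castSucc.2, getD_map_range _ r _ j.2, mul_comm]
    congr 1
    simp only [List.getD_eq_getElem?_getD, List.getElem?_take, Fin.val_castSucc]
    rw [if_pos a.2]
  rw [hproj]
  exact Submodule.sum_mem _ fun j _ => Submodule.smul_mem _ _ (by
    rw [(hB j j.2).1]; exact comboVec_mem M _ (hB j j.2).2)

end HodgeRepro0.P5.DegreeIndexCert
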